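import Summits.Ventures.HodgeRepro.Night4KnownRegime
import Summits.Ventures.HodgeRepro.Night4ReducedDimTransport

/-!
# The §3.2 count split: the cell's dictionary `dim B_red = redDim` and the KERNEL count `redDim = 4` in degree 6

Blind re-derivation cell `pub-hodge-repro`, seat `night-4` (ROUTE HARDENING for the Monday FINAL, gen 1).  Target tree path
`lean/Summits/Ventures/HodgeRepro/Night4ReducedDimRoute.lean`.

`Night4KnownRegime.lean` carries ROUTE.md §3.2's count ("B_red = A × E, an abelian FOURFOLD") as ONE named hypothesis
`ReducedFourfold_deg6`.  This file splits it into (i) the cell's DICTIONARY `DimReduced` — the reduced variety is an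
abelian variety whose dimension is the kernel's `TypeDatum.redDim` (one simple factor of dimension `[F:ℚ]/(2|rstab T|)`
per right-translation class of corner types; Shimura 1998 §8.3 for the induced types, ROUTE.md §1 row S3ᴿ for the
product) — and (ii) the COMBINATORIAL count `RedDimFour_deg6` — every face of a degree-6 datum has `redDim = 4` —, which
is a THEOREM for every interface (`redDimFour_deg6`, from `Route.TypeDatum.redDim_eq_four` of
`Night4ReducedDimTransport.lean`: the census instance on `C6` is `decide +kernel`, p6's classification `(G, c) ≃ (C6, cc_C6)`
and the typer's `isFace_of_sumTwo_of_card_le_eight'` lift it to every degree-6 datum and every face of the roster).  So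
`ReducedFourfold_deg6 ⇐ DimReduced` alone (`ReducedFourfold_deg6_of_DimReduced`), and the §3.2 theorem reads
`S4facesDeg 6 ⇐ AlgPull ∧ LemmaR_faces ∧ DimReduced ∧ Markman2025_Cor1_6_1` (`S4facesDeg6_of_Markman'`),
`S0deg 6 ⇐ AlgPull ∧ S3 ∧ LemmasLPdeg 6 ∧ LemmaR_faces ∧ DimReduced ∧ Markman2025_Cor1_6_1` (`S0deg6_of_Markman'`).

Nothing here says anything about the status of the Hodge conjecture for CM abelian varieties, which is NOT proved.
-/

set_option autoImplicit false

namespace HodgeRepro.Route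

variable (𝓚 : KnownRegimeData)

/-- **The dictionary for `B_red`** (the cell's, UNPRINTED as a sentence; its ingredients printed — Shimura 1998 §8.3: a CM
variety whose type is induced from a CM subfield is isogenous to a power of the variety of the induced type): for every
face `Δ` of a CM `A`, the reduced variety `reduced A Δ = B_red = ∏_j A_j` is an abelian variety of dimension
`Σ_j dim A_j = Σ_{classes} [F:ℚ] / (2 |rstab T|) = TypeDatum.redDim (typeOf A) Δ`. -/
def DimReduced : Prop :=
  ∀ A : 𝓚.Var, 𝓚.IsCM A → ∀ Δ : Finset (𝓚.typeOf A).S, (𝓚.typeOf A).IsFace Δ →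
    𝓚.IsAbelian (𝓚.reduced A Δ) ∧ 𝓚.dim (𝓚.reduced A Δ) = (𝓚.typeOf A).redDim Δ

/-- **The combinatorial count in degree 6** — every face of a type datum with `|G| = 6` has reduced dimension `4`
(ROUTE.md §3.2: three primitive corners in one class of dimension 3, one lift corner of dimension 1).  A THEOREM for every
interface: `redDimFour_deg6`. -/
def RedDimFour_deg6 : Prop :=
  ∀ A : 𝓚.Var, 𝓚.IsCM A → Fintype.card (𝓚.typeOf A).G = 6 →
    ∀ Δ : Finset (𝓚.typeOf A).S, (𝓚.typeOf A).IsFace Δ → (𝓚.typeOf A).redDim Δ = 4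

/-- **The count is a theorem**: `TypeDatum.redDim_eq_four` on the type datum of every CM `A` of degree 6. -/
theorem redDimFour_deg6 : RedDimFour_deg6 𝓚 :=
  fun _ _ hG Δ hΔ => TypeDatum.redDim_eq_four _ hG Δ hΔ

/-- The one-piece count of `Night4KnownRegime.lean` from its two pieces. -/
theorem ReducedFourfold_deg6_of (hD : DimReduced 𝓚) (h4 : RedDimFour_deg6 𝓚) : ReducedFourfold_deg6 𝓚 := by
  intro A hA hG Δ hΔ
  obtain ⟨hab, hdim⟩ := hD A hA Δ hΔ
  exact ⟨hab, hdim.trans (h4 A hA hG Δ hΔ)⟩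

/-- **The one-piece count from the dictionary alone** (the combinatorial half being a theorem). -/
theorem ReducedFourfold_deg6_of_DimReduced (hD : DimReduced 𝓚) : ReducedFourfold_deg6 𝓚 :=
  ReducedFourfold_deg6_of 𝓚 hD (redDimFour_deg6 𝓚)

/-- **ROUTE.md §3.2 "Degree 6 — CLOSED", with the count split**: `S4facesDeg 6 ⇐ AlgPull ∧ LemmaR_faces ∧ DimReduced ∧
Markman2025_Cor1_6_1` — the cell's inputs are now Lemma R and the dictionary only; the count is kernel. -/
theorem S4facesDeg6_of_Markman' (hpull : AlgPull 𝓚.toRouteData) (hR : LemmaR_faces 𝓚) (hD : DimReduced 𝓚)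
    (hM : Markman2025_Cor1_6_1 𝓚) : S4facesDeg 𝓚.toRouteData 6 :=
  S4facesDeg6_of_Markman 𝓚 hpull hR (ReducedFourfold_deg6_of_DimReduced 𝓚 hD) hM

/-- **ROUTE.md §3.2 + §3.6 (i) with the count split**: `S0deg 6 ⇐ AlgPull ∧ S3 ∧ LemmasLPdeg 6 ∧ LemmaR_faces ∧ DimReduced ∧
Markman2025_Cor1_6_1`. -/
theorem S0deg6_of_Markman' (hpull : AlgPull 𝓚.toRouteData) (h3 : S3 𝓚.toRouteData)
    (hLP : LemmasLPdeg 𝓚.toRouteData 6) (hR : LemmaR_faces 𝓚) (hD : DimReduced 𝓚)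
    (hM : Markman2025_Cor1_6_1 𝓚) : S0deg 𝓚.toRouteData 6 :=
  S0deg6_of_Markman 𝓚 hpull h3 hLP hR (ReducedFourfold_deg6_of_DimReduced 𝓚 hD) hM

end HodgeRepro.Route
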